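import Literature.NumberTheory.GaloisCohomology.Howard2004.LevelDataCanonical
import Literature.NumberTheory.GaloisCohomology.Howard2004.FrobIdealRingChangeProofs
import Literature.NumberTheory.EllipticCurves.ZpExtensionEisensteinTowerExactProofs
import Literature.NumberTheory.EllipticCurves.ZpExtensionEisensteinSelmerTriple
import Literature.NumberTheory.EllipticCurves.ZpExtensionEisensteinTwistResidualTau
import Literature.NumberTheory.EllipticCurves.ZpExtensionEisensteinTwistDualityDatum
import Literature.NumberTheory.EllipticCurves.ZpExtensionEisensteinSelmerStructureProofs
import Literature.NumberTheory.EllipticCurves.IwasawaAlgebraEisensteinQuotientDVRProofs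
import HarnessLib

/-!
# The Eisenstein specialisation of the curve as a term of Howard's `DVRSetting` (§1.6 data, assembled)

Topic `NumberTheory/EllipticCurves` (D1 road of cell `pub/bsd-print-x9`; consumer-facing ASSEMBLY of the typed
§1.6 data `Literature.NumberTheory.GaloisCohomology.Howard2004.DVRSetting` of
`GaloisCohomology/Howard2004/DVRKolyvaginBound` for B. Howard, *The Heegner point Kolyvagin system*, Compositio
Math. **140** (2004), at the Eisenstein prime `𝔮 = (T^m + p)` of the anticyclotomic deformation of `T_p E`:
«taking `𝔮 = T^m + p` … `S_𝔮 = Λ/𝔮` is a discrete valuation ring … `T_𝔮 = 𝐓 ⊗_Λ S_𝔮`» [proof of Thm. 2.2.10;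
§1.6, arXiv:1202.6340 p. 11 L13–38, p. 12 L29–55]).  DEFINITIONS WITH BODIES + unfolding/bridge theorems; no named
fact, no instance, no notation, no `sorry`.  Nothing about Selmer groups is asserted; BSD is not proved by any of this.

What is assembled (all pieces are the tree's, cited by name):
* the DVR `R = S_m = Λ/(T^m + p)` (`IwasawaAlgebra.isDiscreteValuationRing_quotient_X_pow_add_C`), uniformiser
  `π = T mod 𝔮`, exponents `e_k = m(k+1)`;
* the level rings `R_k = A_{m,k+1} = Λ/(T^m + p, p^{k+1})` (`IwasawaAlgebra.EisensteinCoeff`) with their `S_m`-algebra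
  structure `EisensteinCoeff.algebraOfSpec` (the reduction `ofSpec`, a `def`, not an instance) and the reductions
  `redR k = EisensteinCoeff.reduce`;
* the tower `T^{(k)} = T_𝔮/p^{k+1} T_𝔮 = E[p^{k+1}] ⊗ A_{m,k+1}(ψ)` (`ZpExtension.eisensteinAdicTowerSucc`, p643239) on
  the torsion modules `WeierstrassCurve.torsionGaloisModule` of `E_K = W.baseChange K` along the multiplication-by-`p`
  transitions `WeierstrassCurve.torsionGaloisModuleReduce` (the tree's `geomTorsionReduce` packaged `→ⁱL`);
* the Selmer triples `(T^{(k)}, F_𝔮, 𝓛)` (`WeierstrassCurve.eisensteinSelmerTriple`, p645106) with the ordinary data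
  `WeierstrassCurve.ordinaryFiltrationAt` at `v ∣ p`, `Σ(F) = ∞ ∪ S`;
* the residual presentation `T̄ = E_K[p]` (`WeierstrassCurve.exists_isQuotientBy_eisensteinTwist_geomTorsion`,
  p641697, pinned by `π̄(1 ⊗ P) = p^k P`) with the `A_{m,k+1}`-module structure `EisensteinCoeff.residueModule`, and
  the `G_ℚ`-structure `θ = τ_*` (`WeierstrassCurve.residualTauGeomTorsion`, p642668);
* the CANONICAL presentations `T^{(k)}/I_n T^{(k)} := T^{(k)} ⧸ I_n • T^{(k)}` of the Kolyvagin quotients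
  (`Howard2004.LevelData.canonical`, p643878), their reductions `rq` along the tower (well defined because
  `I_n(A_{m,k+2}, T^{(k+1)})` reduces into `I_n(A_{m,k+1}, T^{(k)})`: `IsQuotientBy.map_levelIdeal_le` of
  `FrobIdealRingChangeProofs`, the tower being EXACT, `ZpExtensionEisensteinTowerExactProofs`), and the maps `fsQ`
  induced on singular quotients (`H¹(rq)` preserves unramified classes);
* PARAMETERS (data the tree does not pin canonically, each an honest slot of the source): the complex conjugation
  datum `cd` (`Howard2004.ConjugationDatum`; the tree's constructor is `ConjugationDatum.ofLifts`), the H.4 pairing data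
  `D k` (`Howard2004.DualityDatum`; the tree's constructor is `ZpExtension.eisensteinDualityDatum` from an `E`-level
  form, whose level-COMPATIBLE Weil-pairing input is not pinned in the tree), the finite–singular comparison maps `fs`
  (a SLOT by the design of `LevelData`, reading note (i) of `SelmerTriples`; lit g31 FINDING (E): to be constrained by
  the naturality/bijectivity clauses of `SatisfiesH`), the prime set `𝓛` (Howard: `𝓛 ⊃ 𝓛_s(T)`, `𝓛 ∩ Σ(F) = ∅`), the
  bad set `S ⊇ {v ∣ p}` and the embedding `jbar`.

Sections: §1 the `S_m`-algebra `A_{m,k}` and the scalar tower on the levels; §2 the transitions `E[p^{k+1}] → E[p^k]`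
as intertwining maps; §3 the reductions of the canonical Kolyvagin quotients along an exact Eisenstein tower
(generic in the module tower `M`); §4 the induced maps of singular quotients; §5 the assembly
`WeierstrassCurve.eisensteinDVRSetting` and its unfolding lemmas (the residual presentation's formula
`π̄_k(1 ⊗ P) = p^k P` and `IsQuotientBy … (π̄ k)` = the first clause of H.1, by `Classical.choose_spec`).

CONSUMER PREAMBLE.  `Howard2004.DVRSetting` binds its rings/modules through INSTANCE arguments, and the projections
(`.T`, `.t`, `.SatisfiesH`, `.KolyvaginSystem`, `.Conclusion`, …) re-synthesise them; this file declares NO instance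
(typing rule), so every declaration mentioning `W.eisensteinDVRSetting κ hm S hpS hbad L hL hLS jbar cd D fs` must
bring the six instance TERMS into scope, verbatim as in the type of the definition:
```
set_option synthInstance.maxHeartbeats 80000 in   -- the quotient-module scalar towers under the binders `∀ k n`
theorem … :
    letI := IwasawaAlgebra.isDomain_quotient_X_pow_add_C p hm
    letI := IwasawaAlgebra.isDiscreteValuationRing_quotient_X_pow_add_C p hm
    haveI := IwasawaAlgebra.EisensteinCoeff.isLocalRing_succ p hm
    letI := IwasawaAlgebra.EisensteinCoeff.algebraOfSpecSucc p m
    haveI := W.isScalarTower_algebraOfSpecSucc (K := K) (p := p) (m := m)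
    letI := W.residueModuleSucc (K := K) (p := p) hm
    … (W.eisensteinDVRSetting κ hm S hpS hbad L hL hLS jbar cd D fs) … := …
```
(`synthInstance.maxHeartbeats 80000`: the instance `∀ k n, IsScalarTower S_m A_{m,k+1} (T^{(k)} ⧸ I_n • T^{(k)})`
required by the signature of `DVRSetting` is Mathlib's `Submodule.Quotient.isScalarTower` found through the local
families; the search exceeds the default budget, nothing else is non-standard.)

References: [Howard2004HeegnerKolyvagin] §1.2 Def. 1.2.1–1.2.3, §1.3, §1.6 (arXiv p. 11 L13–38, p. 12 L29–55), §2.2,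
proof of Thm. 2.2.10; [Washington1997] §13.2; [SilvermanAEC2009] III.§7, VIII.§2.
-/

set_option autoImplicit false

noncomputable section

open Function NumberField IsDedekindDomain Field
open scoped NumberField ContRepresentation TensorProduct Classical

namespace Literature.NumberTheory.EllipticCurves

open Literature.NumberTheory.GaloisRepresentations
open Literature.NumberTheory.GaloisCohomology.Howard2004

/-! ## §1 `A_{m,k}` as an `S_m`-algebra; the scalar tower `S_m → A_{m,k} → End(M_k ⊗ A_{m,k})` -/

namespace IwasawaAlgebra.EisensteinCoeff

variable (p : ℕ) [hp : Fact p.Prime] (m k : ℕ)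

/-- **`A_{m,k} = Λ/(q_m, p^k)` as an algebra over Howard's DVR `S_m = Λ/(q_m)`** through the reduction
`ofSpec : S_m ↠ A_{m,k}` (the level ring `R_k = R/𝔪^{e_k}` over `R`).  A `def` (use with `letI`), not an instance.
[cite: Howard2004HeegnerKolyvagin, §1.6 (arXiv p. 11, L13–20: the level rings R/𝔪^{e_k}) and §2.2 (S_𝔮 ↠ S_𝔮/p^k)] -/
abbrev algebraOfSpec :
    Algebra (IwasawaAlgebra p ⧸ Ideal.span {(PowerSeries.X ^ m + PowerSeries.C (p : ℤ_[p]) : IwasawaAlgebra p)})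
      (EisensteinCoeff p m k) :=
  (ofSpec p m k).toAlgebra

/-- Under `algebraOfSpec` the structure map is `ofSpec`. [cite: Howard2004HeegnerKolyvagin, §1.6 (arXiv p. 11, L13–20)] -/
theorem algebraMap_algebraOfSpec :
    (letI := algebraOfSpec p m k
     algebraMap (IwasawaAlgebra p ⧸
        Ideal.span {(PowerSeries.X ^ m + PowerSeries.C (p : ℤ_[p]) : IwasawaAlgebra p)}) (EisensteinCoeff p m k)) =
      ofSpec p m k :=
  rfl

/-- The `S_m`-algebra structures of the level rings `R_k = A_{m,k+1}` of Howard's tower, as a family over the tower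
index `k` (use with `letI`; the CONSUMER PREAMBLE of the module docstring). [cite: Howard2004HeegnerKolyvagin, §1.6 (arXiv p. 11, L13–20)] -/
abbrev algebraOfSpecSucc (k : ℕ) :
    Algebra (IwasawaAlgebra p ⧸ Ideal.span {(PowerSeries.X ^ m + PowerSeries.C (p : ℤ_[p]) : IwasawaAlgebra p)})
      (EisensteinCoeff p m (k + 1)) :=
  algebraOfSpec p m (k + 1)

variable {m} in
/-- The level rings `R_k = A_{m,k+1}` are local (`isLocalRing_eisensteinCoeff`, `m ≥ 1`, `k+1 ≥ 1`), as a family over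
the tower index. [cite: Howard2004HeegnerKolyvagin, §1.6 (arXiv p. 11, L13–20: R_k = R/𝔪^{e_k} is local)] -/
theorem isLocalRing_succ (hm : 1 ≤ m) (k : ℕ) : IsLocalRing (EisensteinCoeff p m (k + 1)) :=
  isLocalRing_eisensteinCoeff p hm k.succ_pos

end IwasawaAlgebra.EisensteinCoeff

namespace ZpExtension.EisensteinLevel

variable (p : ℕ) [hp : Fact p.Prime] (m : ℕ) (M : ℕ → Type) [∀ k, AddCommGroup (M k)] (k : ℕ)

/-- **`S_m → A_{m,k} → End(M_k ⊗ A_{m,k})` is a scalar tower**: the `S_m`-action on the level carrier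
(`instModuleQuotient`, through `S_m ↠ A_{m,k}`) factors through the `A_{m,k}`-action along `algebraOfSpec`.
[cite: Howard2004HeegnerKolyvagin, §1.6 (T^{(k)} ∈ Mod_{R_k,K} is an R-module through R ↠ R_k) and §2.2] -/
theorem isScalarTower_algebraOfSpec :
    letI := IwasawaAlgebra.EisensteinCoeff.algebraOfSpec p m k
    IsScalarTower (IwasawaAlgebra p ⧸
        Ideal.span {(PowerSeries.X ^ m + PowerSeries.C (p : ℤ_[p]) : IwasawaAlgebra p)})
      (IwasawaAlgebra.EisensteinCoeff p m k) (EisensteinLevel p m M k) := by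
  letI := IwasawaAlgebra.EisensteinCoeff.algebraOfSpec p m k
  refine ⟨fun r c x => ?_⟩
  obtain ⟨f, rfl⟩ := Ideal.Quotient.mk_surjective r
  rw [Algebra.smul_def, IwasawaAlgebra.EisensteinCoeff.algebraMap_algebraOfSpec,
    IwasawaAlgebra.EisensteinCoeff.ofSpec_mk, mul_smul, EisensteinLevel.quotient_mk_smul_def]

end ZpExtension.EisensteinLevel

end Literature.NumberTheory.EllipticCurves

/-! ## §2 The transitions `E[p^{k+1}] → E[p^k]`, `P ↦ p • P`, as intertwining maps of discrete `Γ_K`-modules -/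

namespace WeierstrassCurve

open Literature.NumberTheory.EllipticCurves Literature.NumberTheory.GaloisRepresentations

variable {K : Type} [Field K] (W : WeierstrassCurve K) (p : ℕ)

/-- **Multiplication by `p`, `E[p^{k+1}] → E[p^k]`**, as a continuous `Γ_K`-intertwining map of the discrete Galois
modules `torsionGaloisModule` (the tree's additive `geomTorsionReduce`, packaged; the transition maps of the tower
`T_p E = lim E[p^k]` read modulo `p^k`). [cite: SilvermanAEC2009, III.§7 (the Tate module: lim E[p^k] along [p])] -/
def torsionGaloisModuleReduce (k : ℕ) :
    (W.torsionGaloisModule ((p : ℤ) ^ (k + 1))).toContRepresentation →ⁱL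
      (W.torsionGaloisModule ((p : ℤ) ^ k)).toContRepresentation where
  toContinuousLinearMap :=
    ⟨(W.geomTorsionReduce p k).toIntLinearMap, continuous_of_discreteTopology⟩
  isIntertwining' σ := by
    ext P
    change (p : ℤ) • ((σ • P : geomTorsion W ((p : ℤ) ^ (k + 1))) : geomPoints W) =
      σ • ((p : ℤ) • (P : geomPoints W))
    rw [Literature.NumberTheory.EllipticCurves.AddSubgroup.torsionBy.coe_smul, smul_zsmul_geomPoints]

/-- Unfolding: `torsionGaloisModuleReduce` IS `geomTorsionReduce`. [cite: SilvermanAEC2009, III.§7] -/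
@[simp]
theorem torsionGaloisModuleReduce_apply (k : ℕ) (P : geomTorsion W ((p : ℤ) ^ (k + 1))) :
    W.torsionGaloisModuleReduce p k P = W.geomTorsionReduce p k P :=
  rfl

/-- On underlying points `torsionGaloisModuleReduce` is `P ↦ p • P`. [cite: SilvermanAEC2009, III.§7] -/
theorem coe_torsionGaloisModuleReduce (k : ℕ) (P : geomTorsion W ((p : ℤ) ^ (k + 1))) :
    ((W.torsionGaloisModuleReduce p k P : geomTorsion W ((p : ℤ) ^ k)) : geomPoints W) =
      (p : ℤ) • (P : geomPoints W) :=
  rfl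

/-- `E[p^{k+1}] → E[p^k]`, `P ↦ p • P`, is onto over `K̄` (divisibility of `E(K̄)`; the tree's
`torsionGaloisModule_lift_surjective`). [cite: SilvermanAEC2009, VIII.§2 (0 → E[m] → E(K̄) → E(K̄) → 0)] -/
theorem torsionGaloisModuleReduce_surjective [Fact p.Prime] [W.IsElliptic] (k : ℕ) :
    Function.Surjective (W.torsionGaloisModuleReduce p k) :=
  W.torsionGaloisModule_lift_surjective (p := p) k _ (W.coe_torsionGaloisModuleReduce p k)

/-- The kernel of `P ↦ p • P` on `E[p^{k+1}]` is `p^k • E[p^{k+1}]` (the tree's `torsionGaloisModule_lift_eq_zero_iff`).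
[cite: SilvermanAEC2009, VIII.§2 (0 → E[m] → E(K̄) → E(K̄) → 0)] -/
theorem torsionGaloisModuleReduce_eq_zero_iff [Fact p.Prime] [W.IsElliptic] (k : ℕ)
    (P : geomTorsion W ((p : ℤ) ^ (k + 1))) :
    W.torsionGaloisModuleReduce p k P = 0 ↔ ∃ Q : geomTorsion W ((p : ℤ) ^ (k + 1)), P = ((p : ℤ) ^ k) • Q :=
  W.torsionGaloisModule_lift_eq_zero_iff (p := p) k _ (W.coe_torsionGaloisModuleReduce p k) P

end WeierstrassCurve


/-! ## §3 The reductions of the canonical Kolyvagin quotients `T^{(k+1)}/I_n → T^{(k)}/I_n` along an EXACT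
Eisenstein tower (generic in the module tower `M_k`, transitions `t k` onto with kernel `p^k M_{k+1}`) -/

namespace Literature.NumberTheory.EllipticCurves.ZpExtension

open Literature.NumberTheory.GaloisRepresentations
open Literature.NumberTheory.GaloisRepresentations.DiscreteGaloisModule
open Literature.NumberTheory.GaloisCohomology.Howard2004
open scoped Pointwise

section LevelReduce

variable {K : Type} [Field K] [NumberField K] {p : ℕ} [hp : Fact p.Prime] (κ : ZpExtension K p)
  {M : ℕ → Type} [∀ k, AddCommGroup (M k)] [∀ k, TopologicalSpace (M k)] [∀ k, DiscreteTopology (M k)]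
  (ρ : ∀ k, DiscreteGaloisModule K (M k))
  (t : ∀ k, (ρ (k + 1)).toContRepresentation →ⁱL (ρ k).toContRepresentation)
  {m : ℕ} (hm : 1 ≤ m) (ht : ∀ k, Function.Surjective (t k))

omit [NumberField K] in
/-- **`Γ_K` acts `A_{m,k+1}`-linearly on the level `T^{(k)} = M_{k+1} ⊗ A_{m,k+1}(ψ)`** of the shifted Eisenstein tower
(`eisensteinTwist_apply_smul`) — Howard's «`T^{(k)}` is an object of `Mod_{R_k, K}`», the `IsScalarLinear` input of the
canonical level data `LevelData.canonical` over the level ring. [cite: Howard2004HeegnerKolyvagin, §1.6 (arXiv p. 11, L33–38) and §2.2] -/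
theorem isScalarLinear_eisensteinAdicTowerSucc_coeff (k : ℕ) :
    letI := IwasawaAlgebra.isLocalRing_quotient_X_pow_add_C p hm
    ((κ.eisensteinAdicTowerSucc ρ t hm ht).ρ k).IsScalarLinear (IwasawaAlgebra.EisensteinCoeff p m (k + 1)) :=
  fun σ c x ↦ κ.eisensteinTwist_apply_smul (ρ (k + 1)) hm (k + 1) σ c x

omit [NumberField K] in
/-- **The tower is EXACT in the currency of the level rings**: the kernel of the reduction
`T^{(k+1)} ↠ T^{(k)}` is `(p^{k+1}) • T^{(k+1)}` for the ideal `(p^{k+1}) ⊂ A_{m,k+2}` (from the tree's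
`ker_eisensteinLevelRed`, `𝔪_{S_m}^{m(k+1)} = (p^{k+1})`), when the transitions `t k` are onto with kernel `p^k M_{k+1}`.
[cite: Howard2004HeegnerKolyvagin, §1.6 (arXiv p. 12: the exact tower T/𝔪^{e_k}) and proof of Thm. 2.2.10] -/
theorem mem_ker_red_eisensteinAdicTowerSucc_iff
    (hkt : ∀ k (x : M (k + 1)), t k x = 0 ↔ ∃ y : M (k + 1), x = ((p : ℤ) ^ k) • y) (k : ℕ)
    (x : EisensteinLevel p m M (k + 1 + 1)) :
    letI := IwasawaAlgebra.isLocalRing_quotient_X_pow_add_C p hm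
    (κ.eisensteinAdicTowerSucc ρ t hm ht).red k x = 0 ↔
      x ∈ ((Ideal.span {((p : ℕ) : IwasawaAlgebra.EisensteinCoeff p m (k + 1 + 1)) ^ (k + 1)}) •
        (⊤ : Submodule (IwasawaAlgebra.EisensteinCoeff p m (k + 1 + 1)) (EisensteinLevel p m M (k + 1 + 1))) :
        Submodule (IwasawaAlgebra.EisensteinCoeff p m (k + 1 + 1)) (EisensteinLevel p m M (k + 1 + 1))) := by
  letI := IwasawaAlgebra.isLocalRing_quotient_X_pow_add_C p hm
  have hker := κ.ker_eisensteinLevelRed ρ t hm (k + 1) (ht (k + 1)) (hkt (k + 1))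
  rw [IwasawaAlgebra.maximalIdeal_pow_mul_eq_span_natCast_pow p hm (k + 1),
    Submodule.ideal_span_singleton_smul] at hker
  have h1 : (κ.eisensteinAdicTowerSucc ρ t hm ht).red k x = 0 ↔ x ∈ LinearMap.ker (κ.eisensteinLevelRed ρ t hm (k + 1)) :=
    Iff.rfl
  rw [h1, hker, Submodule.ideal_span_singleton_smul, Submodule.mem_smul_pointwise_iff_exists,
    Submodule.mem_smul_pointwise_iff_exists]
  constructor
  · rintro ⟨y, -, rfl⟩
    refine ⟨y, Submodule.mem_top, ?_⟩
    rw [← map_natCast (Ideal.Quotient.mk _), ← map_pow, ← map_natCast (Ideal.Quotient.mk _), ← map_pow,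
      EisensteinLevel.quotient_mk_smul_def]
  · rintro ⟨y, -, rfl⟩
    refine ⟨y, Submodule.mem_top, ?_⟩
    rw [← map_natCast (Ideal.Quotient.mk _), ← map_pow, ← map_natCast (Ideal.Quotient.mk _), ← map_pow,
      EisensteinLevel.quotient_mk_smul_def]

/-- **`I_n` reduces into `I_n` down the tower**: the reduction `A_{m,k+2} ↠ A_{m,k+1}` maps Howard's
`I_n(A_{m,k+2}, T^{(k+1)})` into `I_n(A_{m,k+1}, T^{(k)})` (the tree's `IsQuotientBy.map_levelIdeal_le`, Rem. 1.2.4,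
applied to the exact reduction `T^{(k+1)} ↠ T^{(k)} = T^{(k+1)}/p^{k+1}`).
[cite: Howard2004HeegnerKolyvagin, Def. 1.2.1 and Rem. 1.2.4 (arXiv p. 6 L63–75, p. 7 L13–27)] -/
theorem reduce_mem_levelIdeal_eisensteinAdicTowerSucc
    (hkt : ∀ k (x : M (k + 1)), t k x = 0 ↔ ∃ y : M (k + 1), x = ((p : ℤ) ^ k) • y) (k : ℕ)
    (n : Finset (HeightOneSpectrum (𝓞 K))) {c : IwasawaAlgebra.EisensteinCoeff p m (k + 1 + 1)}
    (hc : letI := IwasawaAlgebra.isLocalRing_quotient_X_pow_add_C p hm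
      c ∈ levelIdeal (R := IwasawaAlgebra.EisensteinCoeff p m (k + 1 + 1))
        ((κ.eisensteinAdicTowerSucc ρ t hm ht).ρ (k + 1)) n) :
    letI := IwasawaAlgebra.isLocalRing_quotient_X_pow_add_C p hm
    IwasawaAlgebra.EisensteinCoeff.reduce p m (Nat.le_succ (k + 1)) c ∈
      levelIdeal (R := IwasawaAlgebra.EisensteinCoeff p m (k + 1)) ((κ.eisensteinAdicTowerSucc ρ t hm ht).ρ k) n := by
  letI := IwasawaAlgebra.isLocalRing_quotient_X_pow_add_C p hm
  -- the ring change `φ : A_{m,k+2} ↠ A_{m,k+1}` and `T^{(k)}` read through it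
  letI : Algebra (IwasawaAlgebra.EisensteinCoeff p m (k + 1 + 1)) (IwasawaAlgebra.EisensteinCoeff p m (k + 1)) :=
    (IwasawaAlgebra.EisensteinCoeff.reduce p m (Nat.le_succ (k + 1))).toAlgebra
  letI : Module (IwasawaAlgebra.EisensteinCoeff p m (k + 1 + 1)) (EisensteinLevel p m M (k + 1)) :=
    Module.compHom (EisensteinLevel p m M (k + 1)) (IwasawaAlgebra.EisensteinCoeff.reduce p m (Nat.le_succ (k + 1)))
  haveI : IsScalarTower (IwasawaAlgebra.EisensteinCoeff p m (k + 1 + 1)) (IwasawaAlgebra.EisensteinCoeff p m (k + 1))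
      (EisensteinLevel p m M (k + 1)) :=
    ⟨fun a b x ↦ mul_smul (IwasawaAlgebra.EisensteinCoeff.reduce p m (Nat.le_succ (k + 1)) a) b x⟩
  -- the reduction as an `A_{m,k+2}`-linear map
  let redA : EisensteinLevel p m M (k + 1 + 1) →ₗ[IwasawaAlgebra.EisensteinCoeff p m (k + 1 + 1)]
      EisensteinLevel p m M (k + 1) :=
    { toFun := (κ.eisensteinAdicTowerSucc ρ t hm ht).red k
      map_add' := map_add _
      map_smul' := fun a x ↦ κ.eisensteinTwistReduce_smul hm (Nat.le_succ (k + 1)) (t (k + 1)) a x }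
  have hq : IsQuotientBy (R := IwasawaAlgebra.EisensteinCoeff p m (k + 1 + 1))
      ((κ.eisensteinAdicTowerSucc ρ t hm ht).ρ (k + 1))
      (Ideal.span {((p : ℕ) : IwasawaAlgebra.EisensteinCoeff p m (k + 1 + 1)) ^ (k + 1)})
      ((κ.eisensteinAdicTowerSucc ρ t hm ht).ρ k) redA :=
    { surjective := (κ.eisensteinAdicTowerSucc ρ t hm ht).red_surjective k
      ker_eq := Submodule.ext fun x ↦ κ.mem_ker_red_eisensteinAdicTowerSucc_iff ρ t hm ht hkt k x
      equivariant := fun σ x ↦ (κ.eisensteinAdicTowerSucc ρ t hm ht).red_equivariant k σ x }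
  have hJ : Ideal.span {((p : ℕ) : IwasawaAlgebra.EisensteinCoeff p m (k + 1 + 1)) ^ (k + 1)} ≤
      RingHom.ker (algebraMap (IwasawaAlgebra.EisensteinCoeff p m (k + 1 + 1))
        (IwasawaAlgebra.EisensteinCoeff p m (k + 1))) := by
    rw [Ideal.span_singleton_le_iff_mem, RingHom.mem_ker]
    simpa only [map_pow, map_natCast] using IwasawaAlgebra.natCast_pow_eq_zero_quotient p m (k + 1)
  have hφ : Function.Surjective (algebraMap (IwasawaAlgebra.EisensteinCoeff p m (k + 1 + 1))
      (IwasawaAlgebra.EisensteinCoeff p m (k + 1))) :=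
    IwasawaAlgebra.EisensteinCoeff.reduce_surjective m (Nat.le_succ (k + 1))
  exact hq.map_levelIdeal_le hJ hφ n (Ideal.mem_map_of_mem _ hc)

/-- **The reduction maps `I_n • T^{(k+1)}` into `I_n • T^{(k)}`** (so it descends to the canonical Kolyvagin quotients
`T^{(k+1)}/I_n T^{(k+1)} → T^{(k)}/I_n T^{(k)}`). [cite: Howard2004HeegnerKolyvagin, Def. 1.2.3 and §1.6 (arXiv p. 7 L1–12, p. 11 L49–50)] -/
theorem red_mem_levelIdeal_smul_top_eisensteinAdicTowerSucc
    (hkt : ∀ k (x : M (k + 1)), t k x = 0 ↔ ∃ y : M (k + 1), x = ((p : ℤ) ^ k) • y) (k : ℕ)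
    (n : Finset (HeightOneSpectrum (𝓞 K))) {x : EisensteinLevel p m M (k + 1 + 1)}
    (hx : letI := IwasawaAlgebra.isLocalRing_quotient_X_pow_add_C p hm
      x ∈ ((levelIdeal (R := IwasawaAlgebra.EisensteinCoeff p m (k + 1 + 1))
          ((κ.eisensteinAdicTowerSucc ρ t hm ht).ρ (k + 1)) n) •
        (⊤ : Submodule (IwasawaAlgebra.EisensteinCoeff p m (k + 1 + 1)) (EisensteinLevel p m M (k + 1 + 1))) :
        Submodule (IwasawaAlgebra.EisensteinCoeff p m (k + 1 + 1)) (EisensteinLevel p m M (k + 1 + 1)))) :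
    letI := IwasawaAlgebra.isLocalRing_quotient_X_pow_add_C p hm
    (κ.eisensteinAdicTowerSucc ρ t hm ht).red k x ∈
      ((levelIdeal (R := IwasawaAlgebra.EisensteinCoeff p m (k + 1))
          ((κ.eisensteinAdicTowerSucc ρ t hm ht).ρ k) n) •
        (⊤ : Submodule (IwasawaAlgebra.EisensteinCoeff p m (k + 1)) (EisensteinLevel p m M (k + 1))) :
        Submodule (IwasawaAlgebra.EisensteinCoeff p m (k + 1)) (EisensteinLevel p m M (k + 1))) := by
  letI := IwasawaAlgebra.isLocalRing_quotient_X_pow_add_C p hm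
  induction hx using Submodule.smul_induction_on' with
  | smul c hc y _ =>
    have hred : (κ.eisensteinAdicTowerSucc ρ t hm ht).red k (c • y) =
        IwasawaAlgebra.EisensteinCoeff.reduce p m (Nat.le_succ (k + 1)) c •
          (κ.eisensteinAdicTowerSucc ρ t hm ht).red k y :=
      κ.eisensteinTwistReduce_smul hm (Nat.le_succ (k + 1)) (t (k + 1)) c y
    rw [hred]
    exact Submodule.smul_mem_smul (κ.reduce_mem_levelIdeal_eisensteinAdicTowerSucc ρ t hm ht hkt k n hc)
      Submodule.mem_top
  | add x y _ _ hx hy =>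
    rw [map_add]
    exact Submodule.add_mem _ hx hy

/-- **The reduction `T^{(k+1)}/I_n T^{(k+1)} → T^{(k)}/I_n T^{(k)}` of the CANONICAL Kolyvagin quotients**
(`LevelData.QuotCarrier`), `S_m`-linear, induced by the tower's reduction (Mathlib `Submodule.mapQ`, the two
quotients read as quotients by `S_m`-submodules through `Submodule.Quotient.restrictScalarsEquiv`) — the field `rq`
of Howard's `DVRSetting` for the Eisenstein specialisation.
[cite: Howard2004HeegnerKolyvagin, §1.6 (arXiv p. 11, L49–50: the reductions T^{(k+1)}/I_n → T^{(k)}/I_n) and Def. 1.2.3] -/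
def eisensteinLevelQuotRed
    (hkt : ∀ k (x : M (k + 1)), t k x = 0 ↔ ∃ y : M (k + 1), x = ((p : ℤ) ^ k) • y) (k : ℕ)
    (n : Finset (HeightOneSpectrum (𝓞 K))) :
    letI := IwasawaAlgebra.isLocalRing_quotient_X_pow_add_C p hm
    letI := IwasawaAlgebra.EisensteinCoeff.algebraOfSpec p m (k + 1)
    letI := IwasawaAlgebra.EisensteinCoeff.algebraOfSpec p m (k + 1 + 1)
    haveI := EisensteinLevel.isScalarTower_algebraOfSpec p m M (k + 1)
    haveI := EisensteinLevel.isScalarTower_algebraOfSpec p m M (k + 1 + 1)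
    LevelData.QuotCarrier (IwasawaAlgebra.EisensteinCoeff p m (k + 1 + 1))
        ((κ.eisensteinAdicTowerSucc ρ t hm ht).ρ (k + 1)) n →ₗ[IwasawaAlgebra p ⧸
          Ideal.span {(PowerSeries.X ^ m + PowerSeries.C (p : ℤ_[p]) : IwasawaAlgebra p)}]
      LevelData.QuotCarrier (IwasawaAlgebra.EisensteinCoeff p m (k + 1))
        ((κ.eisensteinAdicTowerSucc ρ t hm ht).ρ k) n :=
  letI := IwasawaAlgebra.isLocalRing_quotient_X_pow_add_C p hm
  letI := IwasawaAlgebra.EisensteinCoeff.algebraOfSpec p m (k + 1)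
  letI := IwasawaAlgebra.EisensteinCoeff.algebraOfSpec p m (k + 1 + 1)
  haveI := EisensteinLevel.isScalarTower_algebraOfSpec p m M (k + 1)
  haveI := EisensteinLevel.isScalarTower_algebraOfSpec p m M (k + 1 + 1)
  (Submodule.Quotient.restrictScalarsEquiv (IwasawaAlgebra p ⧸
        Ideal.span {(PowerSeries.X ^ m + PowerSeries.C (p : ℤ_[p]) : IwasawaAlgebra p)}) _).toLinearMap ∘ₗ
    Submodule.mapQ _ _ ((κ.eisensteinAdicTowerSucc ρ t hm ht).red k)
      (fun _ hx ↦ κ.red_mem_levelIdeal_smul_top_eisensteinAdicTowerSucc ρ t hm ht hkt k n hx) ∘ₗ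
    (Submodule.Quotient.restrictScalarsEquiv (IwasawaAlgebra p ⧸
        Ideal.span {(PowerSeries.X ^ m + PowerSeries.C (p : ℤ_[p]) : IwasawaAlgebra p)})
      ((levelIdeal (R := IwasawaAlgebra.EisensteinCoeff p m (k + 1 + 1))
          ((κ.eisensteinAdicTowerSucc ρ t hm ht).ρ (k + 1)) n) •
        (⊤ : Submodule (IwasawaAlgebra.EisensteinCoeff p m (k + 1 + 1))
          (EisensteinLevel p m M (k + 1 + 1))))).symm.toLinearMap

/-- **`rq ∘ π_{k+1} = π_k ∘ red`** on the canonical presentations (the field `rq_comp`): the reduction of the class of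
`x` is the class of the reduction of `x`. [cite: Howard2004HeegnerKolyvagin, §1.6 (arXiv p. 11, L49–50)] -/
theorem eisensteinLevelQuotRed_mk
    (hkt : ∀ k (x : M (k + 1)), t k x = 0 ↔ ∃ y : M (k + 1), x = ((p : ℤ) ^ k) • y) (k : ℕ)
    (n : Finset (HeightOneSpectrum (𝓞 K))) (x : EisensteinLevel p m M (k + 1 + 1)) :
    letI := IwasawaAlgebra.isLocalRing_quotient_X_pow_add_C p hm
    κ.eisensteinLevelQuotRed ρ t hm ht hkt k n (Submodule.Quotient.mk x) =
      Submodule.Quotient.mk ((κ.eisensteinAdicTowerSucc ρ t hm ht).red k x) :=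
  rfl

/-- The reduction of the canonical Kolyvagin quotients is `Γ_K`-equivariant for the quotient actions `modIdeal`
(the field `rq_equivariant`). [cite: Howard2004HeegnerKolyvagin, §1.6 (arXiv p. 11, L49–50) and Def. 1.1.3] -/
theorem eisensteinLevelQuotRed_equivariant
    (hkt : ∀ k (x : M (k + 1)), t k x = 0 ↔ ∃ y : M (k + 1), x = ((p : ℤ) ^ k) • y) (k : ℕ)
    (n : Finset (HeightOneSpectrum (𝓞 K))) (g : absoluteGaloisGroup K)
    (y : letI := IwasawaAlgebra.isLocalRing_quotient_X_pow_add_C p hm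
      LevelData.QuotCarrier (IwasawaAlgebra.EisensteinCoeff p m (k + 1 + 1))
        ((κ.eisensteinAdicTowerSucc ρ t hm ht).ρ (k + 1)) n) :
    letI := IwasawaAlgebra.isLocalRing_quotient_X_pow_add_C p hm
    κ.eisensteinLevelQuotRed ρ t hm ht hkt k n
        (modIdeal ((κ.eisensteinAdicTowerSucc ρ t hm ht).ρ (k + 1))
          (κ.isScalarLinear_eisensteinAdicTowerSucc_coeff ρ t hm ht (k + 1)) _ g y) =
      modIdeal ((κ.eisensteinAdicTowerSucc ρ t hm ht).ρ k)
        (κ.isScalarLinear_eisensteinAdicTowerSucc_coeff ρ t hm ht k) _ g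
        (κ.eisensteinLevelQuotRed ρ t hm ht hkt k n y) := by
  letI := IwasawaAlgebra.isLocalRing_quotient_X_pow_add_C p hm
  induction y using Submodule.Quotient.induction_on with
  | _ x =>
    rw [modIdeal_apply_mk, eisensteinLevelQuotRed_mk, eisensteinLevelQuotRed_mk, modIdeal_apply_mk,
      (κ.eisensteinAdicTowerSucc ρ t hm ht).red_equivariant k g x]

/-! ## §4 The reduction of the Kolyvagin quotients on local cohomology and on singular quotients (`fsQ`) -/

/-- The reduction `T^{(k+1)}/I_n → T^{(k)}/I_n` of the canonical Kolyvagin quotients as a CONTINUOUS `Γ_K`-INTERTWINING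
map of the discrete quotient modules (`modIdeal`). [cite: Howard2004HeegnerKolyvagin, §1.6 (arXiv p. 11, L49–50) and Def. 1.1.3] -/
def eisensteinLevelQuotRedIL
    (hkt : ∀ k (x : M (k + 1)), t k x = 0 ↔ ∃ y : M (k + 1), x = ((p : ℤ) ^ k) • y) (k : ℕ)
    (n : Finset (HeightOneSpectrum (𝓞 K))) :
    letI := IwasawaAlgebra.isLocalRing_quotient_X_pow_add_C p hm
    (modIdeal ((κ.eisensteinAdicTowerSucc ρ t hm ht).ρ (k + 1))
        (κ.isScalarLinear_eisensteinAdicTowerSucc_coeff ρ t hm ht (k + 1))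
        (levelIdeal (R := IwasawaAlgebra.EisensteinCoeff p m (k + 1 + 1))
          ((κ.eisensteinAdicTowerSucc ρ t hm ht).ρ (k + 1)) n)).toContRepresentation →ⁱL
      (modIdeal ((κ.eisensteinAdicTowerSucc ρ t hm ht).ρ k)
        (κ.isScalarLinear_eisensteinAdicTowerSucc_coeff ρ t hm ht k)
        (levelIdeal (R := IwasawaAlgebra.EisensteinCoeff p m (k + 1))
          ((κ.eisensteinAdicTowerSucc ρ t hm ht).ρ k) n)).toContRepresentation :=
  letI := IwasawaAlgebra.isLocalRing_quotient_X_pow_add_C p hm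
  { toContinuousLinearMap :=
      ⟨(κ.eisensteinLevelQuotRed ρ t hm ht hkt k n).toAddMonoidHom.toIntLinearMap, continuous_of_discreteTopology⟩
    isIntertwining' := fun g ↦ by
      ext y
      exact κ.eisensteinLevelQuotRed_equivariant ρ t hm ht hkt k n g y }

/-- Unfolding: the intertwining map IS the reduction `eisensteinLevelQuotRed`. [cite: Howard2004HeegnerKolyvagin, §1.6 (arXiv p. 11, L49–50)] -/
@[simp]
theorem eisensteinLevelQuotRedIL_apply
    (hkt : ∀ k (x : M (k + 1)), t k x = 0 ↔ ∃ y : M (k + 1), x = ((p : ℤ) ^ k) • y) (k : ℕ)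
    (n : Finset (HeightOneSpectrum (𝓞 K)))
    (y : letI := IwasawaAlgebra.isLocalRing_quotient_X_pow_add_C p hm
      LevelData.QuotCarrier (IwasawaAlgebra.EisensteinCoeff p m (k + 1 + 1))
        ((κ.eisensteinAdicTowerSucc ρ t hm ht).ρ (k + 1)) n) :
    letI := IwasawaAlgebra.isLocalRing_quotient_X_pow_add_C p hm
    κ.eisensteinLevelQuotRedIL ρ t hm ht hkt k n y = κ.eisensteinLevelQuotRed ρ t hm ht hkt k n y :=
  rfl

/-- The reduction of the Kolyvagin quotients restricted to `Γ_{K_v}` at a finite place `v` (an intertwining map of the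
local modules `GaloisRep.toLocal v`; the tree's `ContIntertwiningMap.restrictField`).
[cite: Howard2004HeegnerKolyvagin, §1.6 (arXiv p. 11, L49–50) and Def. 1.1.1] -/
def eisensteinLevelQuotRedLoc
    (hkt : ∀ k (x : M (k + 1)), t k x = 0 ↔ ∃ y : M (k + 1), x = ((p : ℤ) ^ k) • y) (k : ℕ)
    (n : Finset (HeightOneSpectrum (𝓞 K))) (v : HeightOneSpectrum (𝓞 K)) :
    letI := IwasawaAlgebra.isLocalRing_quotient_X_pow_add_C p hm
    (GaloisRep.toLocal v (modIdeal ((κ.eisensteinAdicTowerSucc ρ t hm ht).ρ (k + 1))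
        (κ.isScalarLinear_eisensteinAdicTowerSucc_coeff ρ t hm ht (k + 1))
        (levelIdeal (R := IwasawaAlgebra.EisensteinCoeff p m (k + 1 + 1))
          ((κ.eisensteinAdicTowerSucc ρ t hm ht).ρ (k + 1)) n))).toContRepresentation →ⁱL
      (GaloisRep.toLocal v (modIdeal ((κ.eisensteinAdicTowerSucc ρ t hm ht).ρ k)
        (κ.isScalarLinear_eisensteinAdicTowerSucc_coeff ρ t hm ht k)
        (levelIdeal (R := IwasawaAlgebra.EisensteinCoeff p m (k + 1))
          ((κ.eisensteinAdicTowerSucc ρ t hm ht).ρ k) n))).toContRepresentation :=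
  (κ.eisensteinLevelQuotRedIL ρ t hm ht hkt k n).restrictField (v.adicCompletion K)

/-- Unfolding: at a place `v` the map is still the reduction `eisensteinLevelQuotRed`. [cite: Howard2004HeegnerKolyvagin, §1.6 (arXiv p. 11, L49–50)] -/
@[simp]
theorem eisensteinLevelQuotRedLoc_apply
    (hkt : ∀ k (x : M (k + 1)), t k x = 0 ↔ ∃ y : M (k + 1), x = ((p : ℤ) ^ k) • y) (k : ℕ)
    (n : Finset (HeightOneSpectrum (𝓞 K))) (v : HeightOneSpectrum (𝓞 K))
    (y : letI := IwasawaAlgebra.isLocalRing_quotient_X_pow_add_C p hm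
      LevelData.QuotCarrier (IwasawaAlgebra.EisensteinCoeff p m (k + 1 + 1))
        ((κ.eisensteinAdicTowerSucc ρ t hm ht).ρ (k + 1)) n) :
    letI := IwasawaAlgebra.isLocalRing_quotient_X_pow_add_C p hm
    κ.eisensteinLevelQuotRedLoc ρ t hm ht hkt k n v y = κ.eisensteinLevelQuotRed ρ t hm ht hkt k n y :=
  rfl

/-- **The reduction on SINGULAR QUOTIENTS** `H¹_s(K_v, T^{(k+1)}/I_n) → H¹_s(K_v, T^{(k)}/I_n)` induced by `H¹` of the
reduction of the Kolyvagin quotients at `v` (well defined: `H¹(f)` carries unramified classes to unramified classes,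
the tree's `map_mem_unramifiedSubgroup`) — the field `fsQ` of Howard's `DVRSetting` (the maps along which the
finite–singular comparison maps `φ^{fs}` are natural, `SatisfiesH.fs_natural`).
[cite: Howard2004HeegnerKolyvagin, Def. 1.2.3 display (ks relations) and §1.6 (arXiv p. 6 L126–140, p. 11 L49–50)] -/
def eisensteinLevelQuotRedSingular
    (hkt : ∀ k (x : M (k + 1)), t k x = 0 ↔ ∃ y : M (k + 1), x = ((p : ℤ) ^ k) • y) (k : ℕ)
    (n : Finset (HeightOneSpectrum (𝓞 K))) (v : HeightOneSpectrum (𝓞 K)) :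
    letI := IwasawaAlgebra.isLocalRing_quotient_X_pow_add_C p hm
    SingularQuotient (GaloisRep.toLocal v (modIdeal ((κ.eisensteinAdicTowerSucc ρ t hm ht).ρ (k + 1))
        (κ.isScalarLinear_eisensteinAdicTowerSucc_coeff ρ t hm ht (k + 1))
        (levelIdeal (R := IwasawaAlgebra.EisensteinCoeff p m (k + 1 + 1))
          ((κ.eisensteinAdicTowerSucc ρ t hm ht).ρ (k + 1)) n))) →+
      SingularQuotient (GaloisRep.toLocal v (modIdeal ((κ.eisensteinAdicTowerSucc ρ t hm ht).ρ k)
        (κ.isScalarLinear_eisensteinAdicTowerSucc_coeff ρ t hm ht k)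
        (levelIdeal (R := IwasawaAlgebra.EisensteinCoeff p m (k + 1))
          ((κ.eisensteinAdicTowerSucc ρ t hm ht).ρ k) n))) :=
  letI := IwasawaAlgebra.isLocalRing_quotient_X_pow_add_C p hm
  QuotientAddGroup.map (unramifiedSubgroup _ 1) (unramifiedSubgroup _ 1)
    (galoisCohomology.map (κ.eisensteinLevelQuotRedLoc ρ t hm ht hkt k n v) 1)
    fun x hx ↦ AddSubgroup.mem_comap.mpr
      (Literature.NumberTheory.EllipticCurves.DiscreteGaloisModule.map_mem_unramifiedSubgroup
        (κ.eisensteinLevelQuotRedLoc ρ t hm ht hkt k n v) (x := x) hx)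

/-- On singular classes: `fsQ (singular x) = singular (H¹(rq_v) x)`. [cite: Howard2004HeegnerKolyvagin, Def. 1.2.3 display (ks relations) (arXiv p. 6, L126–140)] -/
theorem eisensteinLevelQuotRedSingular_singularMap
    (hkt : ∀ k (x : M (k + 1)), t k x = 0 ↔ ∃ y : M (k + 1), x = ((p : ℤ) ^ k) • y) (k : ℕ)
    (n : Finset (HeightOneSpectrum (𝓞 K))) (v : HeightOneSpectrum (𝓞 K))
    (x : letI := IwasawaAlgebra.isLocalRing_quotient_X_pow_add_C p hm
      galoisCohomology (GaloisRep.toLocal v (modIdeal ((κ.eisensteinAdicTowerSucc ρ t hm ht).ρ (k + 1))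
        (κ.isScalarLinear_eisensteinAdicTowerSucc_coeff ρ t hm ht (k + 1))
        (levelIdeal (R := IwasawaAlgebra.EisensteinCoeff p m (k + 1 + 1))
          ((κ.eisensteinAdicTowerSucc ρ t hm ht).ρ (k + 1)) n))) 1) :
    letI := IwasawaAlgebra.isLocalRing_quotient_X_pow_add_C p hm
    κ.eisensteinLevelQuotRedSingular ρ t hm ht hkt k n v (singularMap _ x) =
      singularMap _ (galoisCohomology.map (κ.eisensteinLevelQuotRedLoc ρ t hm ht hkt k n v) 1 x) :=
  rfl

end LevelReduce

end Literature.NumberTheory.EllipticCurves.ZpExtension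

/-! ## §5 The assembly: the Eisenstein specialisation `(T_𝔮, F_𝔮, 𝓛)` of `E_K` as a `Howard2004.DVRSetting` -/

namespace WeierstrassCurve

open Literature.NumberTheory.EllipticCurves Literature.NumberTheory.GaloisRepresentations
open Literature.NumberTheory.GaloisRepresentations.DiscreteGaloisModule
open Literature.NumberTheory.GaloisCohomology.Howard2004
open Literature.NumberTheory.EllipticCurves.ZpExtension (EisensteinLevel)

variable {K : Type} [Field K] [NumberField K] (W : WeierstrassCurve ℚ) [W.IsElliptic] {p : ℕ} [hp : Fact p.Prime]
  (κ : ZpExtension K p) {m : ℕ} (hm : 1 ≤ m)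

/-- **Howard's tower `T^{(k)} = T_𝔮/p^{k+1} T_𝔮 = E_K[p^{k+1}] ⊗ A_{m,k+1}(ψ)` for the curve** (`E_K = W.baseChange K`):
the tree's shifted Eisenstein tower `eisensteinAdicTowerSucc` on the torsion modules `E_K[p^k]` along `P ↦ p • P`
(onto by divisibility of `E(K̄)`).  An `abbrev` (the generic tower lemmas apply by unification).
[cite: Howard2004HeegnerKolyvagin, §1.6 (arXiv p. 11 L18–20, p. 12 L29–55) and §2.2, proof of Thm. 2.2.10 (𝔮 = T^m + p)] -/
abbrev eisensteinTower :
    letI := IwasawaAlgebra.isLocalRing_quotient_X_pow_add_C p hm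
    AdicTower K (IwasawaAlgebra p ⧸
        Ideal.span {(PowerSeries.X ^ m + PowerSeries.C (p : ℤ_[p]) : IwasawaAlgebra p)})
      (fun k ↦ EisensteinLevel p m (fun j ↦ geomTorsion (W.baseChange K) ((p : ℤ) ^ j)) (k + 1)) :=
  κ.eisensteinAdicTowerSucc (fun j ↦ (W.baseChange K).torsionGaloisModule ((p : ℤ) ^ j))
    (fun j ↦ (W.baseChange K).torsionGaloisModuleReduce p j) hm
    (fun j ↦ (W.baseChange K).torsionGaloisModuleReduce_surjective p j)

/-- **The canonical Kolyvagin quotient `T^{(k)}/I_n T^{(k)}` of the curve** as a discrete `Γ_K`-module on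
`T^{(k)} ⧸ I_n • T^{(k)}` (`modIdeal`, the Galois action of `LevelData.canonical`), `I_n = I_n(A_{m,k+1}, T^{(k)})`.
An `abbrev`. [cite: Howard2004HeegnerKolyvagin, Def. 1.2.1 and Def. 1.2.3 (arXiv p. 6 L73–75, p. 7 L1–6)] -/
abbrev eisensteinLevelQuot (k : ℕ) (n : Finset (HeightOneSpectrum (𝓞 K))) :
    letI := IwasawaAlgebra.isLocalRing_quotient_X_pow_add_C p hm
    DiscreteGaloisModule K (LevelData.QuotCarrier (IwasawaAlgebra.EisensteinCoeff p m (k + 1))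
      ((W.eisensteinTower κ hm).ρ k) n) :=
  letI := IwasawaAlgebra.isLocalRing_quotient_X_pow_add_C p hm
  modIdeal ((W.eisensteinTower κ hm).ρ k)
    (κ.isScalarLinear_eisensteinAdicTowerSucc_coeff (fun j ↦ (W.baseChange K).torsionGaloisModule ((p : ℤ) ^ j))
      (fun j ↦ (W.baseChange K).torsionGaloisModuleReduce p j) hm
      (fun j ↦ (W.baseChange K).torsionGaloisModuleReduce_surjective p j) k)
    (levelIdeal (R := IwasawaAlgebra.EisensteinCoeff p m (k + 1)) ((W.eisensteinTower κ hm).ρ k) n)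

variable (S : Finset (HeightOneSpectrum (𝓞 K)))
  (hpS : ∀ v : HeightOneSpectrum (𝓞 K), ((p : ℕ) : 𝓞 K) ∈ v.asIdeal → v ∈ S)
  (hbad : ∀ v : HeightOneSpectrum (𝓞 K), v ∉ S → ((p : ℕ) : 𝓞 K) ∉ v.asIdeal → (W.baseChange K).HasGoodReductionAt v)
  (L : Set (HeightOneSpectrum (𝓞 K)))
  (hL : letI := IwasawaAlgebra.isLocalRing_quotient_X_pow_add_C p hm
    L ⊆ (W.eisensteinTower κ hm).degreeTwoPrimes p)
  (hLS : ∀ v ∈ L, v ∉ S)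
  (jbar : AlgebraicClosure K →+* ℂ) (cd : ConjugationDatum K)
  (D : letI := IwasawaAlgebra.isLocalRing_quotient_X_pow_add_C p hm
    ∀ k, DualityDatum p cd ((W.eisensteinTower κ hm).ρ k) (IwasawaAlgebra.EisensteinCoeff p m (k + 1)))
  (fs : letI := IwasawaAlgebra.isLocalRing_quotient_X_pow_add_C p hm
    ∀ (k : ℕ) (n : Finset (HeightOneSpectrum (𝓞 K))) (v : HeightOneSpectrum (𝓞 K)),
      galoisCohomology ((W.eisensteinLevelQuot κ hm k n).toLocal (Sum.inr v)) 1 →+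
        SingularQuotient (GaloisRep.toLocal v (W.eisensteinLevelQuot κ hm k n)) ⊗[ℤ] Gell v)

/-! ### The instance TERMS of the assembly (no instances are declared; consumers bring them into scope with the
CONSUMER PREAMBLE of the module docstring — the projections of `Howard2004.DVRSetting` re-synthesise them) -/

omit [W.IsElliptic] in
/-- The scalar towers `S_m → A_{m,k+1} → End(T^{(k)})` on the levels of the curve's tower, as a family.
[cite: Howard2004HeegnerKolyvagin, §1.6 (arXiv p. 11, L33–38)] -/
theorem isScalarTower_algebraOfSpecSucc (k : ℕ) :
    letI := IwasawaAlgebra.EisensteinCoeff.algebraOfSpecSucc p m k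
    IsScalarTower (IwasawaAlgebra p ⧸
        Ideal.span {(PowerSeries.X ^ m + PowerSeries.C (p : ℤ_[p]) : IwasawaAlgebra p)})
      (IwasawaAlgebra.EisensteinCoeff p m (k + 1))
      (EisensteinLevel p m (fun j ↦ geomTorsion (W.baseChange K) ((p : ℤ) ^ j)) (k + 1)) :=
  ZpExtension.EisensteinLevel.isScalarTower_algebraOfSpec p m _ (k + 1)

omit [W.IsElliptic] in
/-- The `A_{m,k+1}`-module structures on `T̄ = E_K[p]` through the residue character (`residueModule`), as a family.
An `abbrev` (use with `letI`). [cite: Howard2004HeegnerKolyvagin, proof of Prop. 2.1.3 (E[p] ⊗ S_𝔭/𝔪)] -/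
abbrev residueModuleSucc (k : ℕ) :
    Module (IwasawaAlgebra.EisensteinCoeff p m (k + 1)) (geomTorsion (W.baseChange K) (p : ℤ)) :=
  IwasawaAlgebra.EisensteinCoeff.residueModule (p := p) (m := m) (k := k + 1) hm k.succ_pos
    ((W.baseChange K).prime_nsmul_geomTorsion_eq_zero (p := p))

/-- **The Selmer triple `(T^{(k)}, F_𝔮, 𝓛)` of the curve at tower level `k`** (torsion level `k+1`): the tree's
`eisensteinSelmerTriple` with the ordinary data `ordinaryFiltrationAt` at `v ∣ p`, `Σ(F) = ∞ ∪ S`, and the prime set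
`𝓛` (inside `𝓛₀` of every level). [cite: Howard2004HeegnerKolyvagin, §1.2 (arXiv p. 6, L96–100), Def. 3.1.2] -/
def eisensteinTowerTriple (k : ℕ) :
    letI := IwasawaAlgebra.isLocalRing_quotient_X_pow_add_C p hm
    SelmerTriple p ((W.eisensteinTower κ hm).ρ k) :=
  (W.baseChange K).eisensteinSelmerTriple κ hm (fun j ↦ (W.baseChange K).torsionGaloisModuleReduce p j) S
    (fun v _ ↦ (W.baseChange K).ordinaryFiltrationAt v (fun j ↦ (W.baseChange K).torsionGaloisModuleReduce p j)
      (fun _ _ ↦ rfl))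
    hpS hbad (k + 1) L (fun _ hv ↦ Set.mem_iInter.mp (hL hv) k) hLS

set_option synthInstance.maxHeartbeats 80000 in
/-- **The Eisenstein specialisation of `E_K` as Howard's §1.6 data** `DVRSetting p K S_m …`: DVR `S_m = Λ/(T^m + p)`,
uniformiser `π = T`, exponents `e_k = m(k+1)`, tower `T^{(k)} = E_K[p^{k+1}] ⊗ A_{m,k+1}(ψ)`, triples
`(T^{(k)}, F_𝔮, 𝓛)`, residual `T̄ = E_K[p]` (presentation pinned by `π̄(1 ⊗ P) = p^k P`, `G_ℚ`-structure `θ = τ_*`),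
level rings `A_{m,k+1}` with reductions `reduce`, CANONICAL Kolyvagin quotients `T^{(k)} ⧸ I_n • T^{(k)}` with their
reductions `rq` and singular-quotient maps `fsQ`; the conjugation datum `cd`, pairing data `D`, finite–singular maps
`fs`, prime set `𝓛`, bad set `S` and `jbar` are the caller's (see the module docstring).  NOTHING is asserted: the
hypotheses H.0–H.5 (`DVRSetting.SatisfiesH`), `LargePrimes` and a Kolyvagin system are separate obligations.
[cite: Howard2004HeegnerKolyvagin, §1.6 (arXiv p. 11 L13–38, p. 12 L29–55), Def. 1.2.3, §2.2 and proof of Thm. 2.2.10 (𝔮 = T^m + p)] -/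
def eisensteinDVRSetting :
    letI := IwasawaAlgebra.isDomain_quotient_X_pow_add_C p hm
    letI := IwasawaAlgebra.isDiscreteValuationRing_quotient_X_pow_add_C p hm
    haveI := IwasawaAlgebra.EisensteinCoeff.isLocalRing_succ p hm
    letI := IwasawaAlgebra.EisensteinCoeff.algebraOfSpecSucc p m
    haveI := W.isScalarTower_algebraOfSpecSucc (K := K) (p := p) (m := m)
    letI := W.residueModuleSucc (K := K) (p := p) hm
    DVRSetting p K (IwasawaAlgebra p ⧸
        Ideal.span {(PowerSeries.X ^ m + PowerSeries.C (p : ℤ_[p]) : IwasawaAlgebra p)})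
      (fun k ↦ EisensteinLevel p m (fun j ↦ geomTorsion (W.baseChange K) ((p : ℤ) ^ j)) (k + 1))
      (fun k ↦ IwasawaAlgebra.EisensteinCoeff p m (k + 1)) (geomTorsion (W.baseChange K) (p : ℤ))
      (fun k n ↦ LevelData.QuotCarrier (IwasawaAlgebra.EisensteinCoeff p m (k + 1)) ((W.eisensteinTower κ hm).ρ k) n) :=
  letI := IwasawaAlgebra.isDomain_quotient_X_pow_add_C p hm
  letI := IwasawaAlgebra.isDiscreteValuationRing_quotient_X_pow_add_C p hm
  haveI := IwasawaAlgebra.EisensteinCoeff.isLocalRing_succ p hm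
  letI := IwasawaAlgebra.EisensteinCoeff.algebraOfSpecSucc p m
  haveI := W.isScalarTower_algebraOfSpecSucc (K := K) (p := p) (m := m)
  letI := W.residueModuleSucc (K := K) (p := p) hm
  { π := Ideal.Quotient.mk _ PowerSeries.X
    e := fun k ↦ m * (k + 1)
    T := W.eisensteinTower κ hm
    cd := cd
    jbar := jbar
    Sigma := (Finset.univ : Finset (NumberField.InfinitePlace K)).disjSum S
    L := L
    t := W.eisensteinTowerTriple κ hm S hpS hbad L hL hLS
    ρbar := (W.baseChange K).torsionGaloisModule (p : ℤ)
    πbar := fun k ↦ Classical.choose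
      ((W.baseChange K).exists_isQuotientBy_eisensteinTwist_geomTorsion (p := p) κ hm (k := k + 1) k.succ_pos)
    A := fun k ↦ W.residualTauGeomTorsion (p := p) cd hm (k := k + 1) k.succ_pos
    D := D
    redR := fun k ↦ IwasawaAlgebra.EisensteinCoeff.reduce p m (Nat.le_succ (k + 1))
    LD := fun k ↦ LevelData.canonical (IwasawaAlgebra.EisensteinCoeff p m (k + 1)) ((W.eisensteinTower κ hm).ρ k)
      (κ.isScalarLinear_eisensteinAdicTowerSucc_coeff (fun j ↦ (W.baseChange K).torsionGaloisModule ((p : ℤ) ^ j))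
        (fun j ↦ (W.baseChange K).torsionGaloisModuleReduce p j) hm
        (fun j ↦ (W.baseChange K).torsionGaloisModuleReduce_surjective p j) k)
      (W.eisensteinTowerTriple κ hm S hpS hbad L hL hLS k) (fs k)
    rq := fun k n ↦ κ.eisensteinLevelQuotRed (fun j ↦ (W.baseChange K).torsionGaloisModule ((p : ℤ) ^ j))
      (fun j ↦ (W.baseChange K).torsionGaloisModuleReduce p j) hm
      (fun j ↦ (W.baseChange K).torsionGaloisModuleReduce_surjective p j)
      (fun j ↦ (W.baseChange K).torsionGaloisModuleReduce_eq_zero_iff p j) k n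
    rq_comp := fun _ _ _ ↦ rfl
    rq_equivariant := fun k n g y ↦ κ.eisensteinLevelQuotRed_equivariant
      (fun j ↦ (W.baseChange K).torsionGaloisModule ((p : ℤ) ^ j))
      (fun j ↦ (W.baseChange K).torsionGaloisModuleReduce p j) hm
      (fun j ↦ (W.baseChange K).torsionGaloisModuleReduce_surjective p j)
      (fun j ↦ (W.baseChange K).torsionGaloisModuleReduce_eq_zero_iff p j) k n g y
    fsQ := fun k n v ↦ κ.eisensteinLevelQuotRedSingular (fun j ↦ (W.baseChange K).torsionGaloisModule ((p : ℤ) ^ j))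
      (fun j ↦ (W.baseChange K).torsionGaloisModuleReduce p j) hm
      (fun j ↦ (W.baseChange K).torsionGaloisModuleReduce_surjective p j)
      (fun j ↦ (W.baseChange K).torsionGaloisModuleReduce_eq_zero_iff p j) k n v }

/-! ### Unfolding the assembly (every field BY NAME; `rfl` unless stated) -/

set_option synthInstance.maxHeartbeats 80000 in
/-- The tower of the setting is `eisensteinTower`. [cite: Howard2004HeegnerKolyvagin, §1.6 (arXiv p. 11, L18–20)] -/
theorem eisensteinDVRSetting_T :
    letI := IwasawaAlgebra.isDomain_quotient_X_pow_add_C p hm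
    letI := IwasawaAlgebra.isDiscreteValuationRing_quotient_X_pow_add_C p hm
    haveI := IwasawaAlgebra.EisensteinCoeff.isLocalRing_succ p hm
    letI := IwasawaAlgebra.EisensteinCoeff.algebraOfSpecSucc p m
    haveI := W.isScalarTower_algebraOfSpecSucc (K := K) (p := p) (m := m)
    letI := W.residueModuleSucc (K := K) (p := p) hm
    (W.eisensteinDVRSetting κ hm S hpS hbad L hL hLS jbar cd D fs).T = W.eisensteinTower κ hm :=
  rfl

set_option synthInstance.maxHeartbeats 80000 in
/-- The uniformiser of the setting is `π = T mod (T^m + p)`. [cite: Howard2004HeegnerKolyvagin, §1.6 (arXiv p. 11, L13–14) and §2.2] -/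
theorem eisensteinDVRSetting_π :
    letI := IwasawaAlgebra.isDomain_quotient_X_pow_add_C p hm
    letI := IwasawaAlgebra.isDiscreteValuationRing_quotient_X_pow_add_C p hm
    haveI := IwasawaAlgebra.EisensteinCoeff.isLocalRing_succ p hm
    letI := IwasawaAlgebra.EisensteinCoeff.algebraOfSpecSucc p m
    haveI := W.isScalarTower_algebraOfSpecSucc (K := K) (p := p) (m := m)
    letI := W.residueModuleSucc (K := K) (p := p) hm
    (W.eisensteinDVRSetting κ hm S hpS hbad L hL hLS jbar cd D fs).π = Ideal.Quotient.mk _ PowerSeries.X :=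
  rfl

set_option synthInstance.maxHeartbeats 80000 in
/-- The exponents of the setting are `e_k = m(k+1)` (`T^{(k)} = T_𝔮/𝔪^{m(k+1)} = T_𝔮/p^{k+1}`).
[cite: Howard2004HeegnerKolyvagin, §1.6 (arXiv p. 11, L18–20) and proof of Thm. 2.2.10 (𝔪^{mk} = (p^k))] -/
theorem eisensteinDVRSetting_e (k : ℕ) :
    letI := IwasawaAlgebra.isDomain_quotient_X_pow_add_C p hm
    letI := IwasawaAlgebra.isDiscreteValuationRing_quotient_X_pow_add_C p hm
    haveI := IwasawaAlgebra.EisensteinCoeff.isLocalRing_succ p hm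
    letI := IwasawaAlgebra.EisensteinCoeff.algebraOfSpecSucc p m
    haveI := W.isScalarTower_algebraOfSpecSucc (K := K) (p := p) (m := m)
    letI := W.residueModuleSucc (K := K) (p := p) hm
    (W.eisensteinDVRSetting κ hm S hpS hbad L hL hLS jbar cd D fs).e k = m * (k + 1) :=
  rfl

set_option synthInstance.maxHeartbeats 80000 in
/-- The level triples of the setting are `eisensteinTowerTriple` (so their local conditions are Howard's `F_𝔮`,
`eisensteinSelmerStructure`, at torsion level `k+1`). [cite: Howard2004HeegnerKolyvagin, §1.2 and Def. 3.1.2] -/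
theorem eisensteinDVRSetting_t (k : ℕ) :
    letI := IwasawaAlgebra.isDomain_quotient_X_pow_add_C p hm
    letI := IwasawaAlgebra.isDiscreteValuationRing_quotient_X_pow_add_C p hm
    haveI := IwasawaAlgebra.EisensteinCoeff.isLocalRing_succ p hm
    letI := IwasawaAlgebra.EisensteinCoeff.algebraOfSpecSucc p m
    haveI := W.isScalarTower_algebraOfSpecSucc (K := K) (p := p) (m := m)
    letI := W.residueModuleSucc (K := K) (p := p) hm
    (W.eisensteinDVRSetting κ hm S hpS hbad L hL hLS jbar cd D fs).t k =
      W.eisensteinTowerTriple κ hm S hpS hbad L hL hLS k :=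
  rfl

set_option synthInstance.maxHeartbeats 80000 in
/-- The local conditions of the level-`k` triple: `F_𝔮` at torsion level `k+1`. [cite: Howard2004HeegnerKolyvagin, Def. 3.1.2] -/
theorem eisensteinDVRSetting_t_cond (k : ℕ) :
    letI := IwasawaAlgebra.isDomain_quotient_X_pow_add_C p hm
    letI := IwasawaAlgebra.isDiscreteValuationRing_quotient_X_pow_add_C p hm
    haveI := IwasawaAlgebra.EisensteinCoeff.isLocalRing_succ p hm
    letI := IwasawaAlgebra.EisensteinCoeff.algebraOfSpecSucc p m
    haveI := W.isScalarTower_algebraOfSpecSucc (K := K) (p := p) (m := m)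
    letI := W.residueModuleSucc (K := K) (p := p) hm
    ((W.eisensteinDVRSetting κ hm S hpS hbad L hL hLS jbar cd D fs).t k).cond =
      κ.eisensteinSelmerStructure (fun j ↦ (W.baseChange K).torsionGaloisModule ((p : ℤ) ^ j))
        (fun j ↦ (W.baseChange K).torsionGaloisModuleReduce p j) hm S
        (fun v _ ↦ (W.baseChange K).ordinaryFiltrationAt v (fun j ↦ (W.baseChange K).torsionGaloisModuleReduce p j)
          (fun _ _ ↦ rfl)) (k + 1) :=
  rfl

set_option synthInstance.maxHeartbeats 80000 in
/-- `Σ(F) = ∞ ∪ S` at every level. [cite: Howard2004HeegnerKolyvagin, Def. 1.1.10] -/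
theorem eisensteinDVRSetting_t_Sigma (k : ℕ) :
    letI := IwasawaAlgebra.isDomain_quotient_X_pow_add_C p hm
    letI := IwasawaAlgebra.isDiscreteValuationRing_quotient_X_pow_add_C p hm
    haveI := IwasawaAlgebra.EisensteinCoeff.isLocalRing_succ p hm
    letI := IwasawaAlgebra.EisensteinCoeff.algebraOfSpecSucc p m
    haveI := W.isScalarTower_algebraOfSpecSucc (K := K) (p := p) (m := m)
    letI := W.residueModuleSucc (K := K) (p := p) hm
    ((W.eisensteinDVRSetting κ hm S hpS hbad L hL hLS jbar cd D fs).t k).Sigma =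
      (W.eisensteinDVRSetting κ hm S hpS hbad L hL hLS jbar cd D fs).Sigma :=
  rfl

set_option synthInstance.maxHeartbeats 80000 in
/-- The prime set of every level triple is `𝓛`. [cite: Howard2004HeegnerKolyvagin, §1.2 (arXiv p. 6, L96–100)] -/
theorem eisensteinDVRSetting_t_primes (k : ℕ) :
    letI := IwasawaAlgebra.isDomain_quotient_X_pow_add_C p hm
    letI := IwasawaAlgebra.isDiscreteValuationRing_quotient_X_pow_add_C p hm
    haveI := IwasawaAlgebra.EisensteinCoeff.isLocalRing_succ p hm
    letI := IwasawaAlgebra.EisensteinCoeff.algebraOfSpecSucc p m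
    haveI := W.isScalarTower_algebraOfSpecSucc (K := K) (p := p) (m := m)
    letI := W.residueModuleSucc (K := K) (p := p) hm
    ((W.eisensteinDVRSetting κ hm S hpS hbad L hL hLS jbar cd D fs).t k).primes =
      (W.eisensteinDVRSetting κ hm S hpS hbad L hL hLS jbar cd D fs).L :=
  rfl

set_option synthInstance.maxHeartbeats 80000 in
/-- The residual representation of the setting is `E_K[p]`. [cite: Howard2004HeegnerKolyvagin, proof of Prop. 2.1.3 (T̄ ≅ E[p] ⊗ S/𝔪)] -/
theorem eisensteinDVRSetting_ρbar :
    letI := IwasawaAlgebra.isDomain_quotient_X_pow_add_C p hm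
    letI := IwasawaAlgebra.isDiscreteValuationRing_quotient_X_pow_add_C p hm
    haveI := IwasawaAlgebra.EisensteinCoeff.isLocalRing_succ p hm
    letI := IwasawaAlgebra.EisensteinCoeff.algebraOfSpecSucc p m
    haveI := W.isScalarTower_algebraOfSpecSucc (K := K) (p := p) (m := m)
    letI := W.residueModuleSucc (K := K) (p := p) hm
    (W.eisensteinDVRSetting κ hm S hpS hbad L hL hLS jbar cd D fs).ρbar = (W.baseChange K).torsionGaloisModule (p : ℤ) :=
  rfl

set_option synthInstance.maxHeartbeats 80000 in
/-- **The residual presentation on pure tensors: `π̄_k(1 ⊗ P) = p^k • P`** (`E_K[p^{k+1}] ↠ E_K[p]`).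
[cite: Howard2004HeegnerKolyvagin, proof of Prop. 2.1.3 and §1.3 H.1] -/
theorem coe_eisensteinDVRSetting_πbar_tmul (k : ℕ) (P : geomTorsion (W.baseChange K) ((p : ℤ) ^ (k + 1))) :
    letI := IwasawaAlgebra.isDomain_quotient_X_pow_add_C p hm
    letI := IwasawaAlgebra.isDiscreteValuationRing_quotient_X_pow_add_C p hm
    haveI := IwasawaAlgebra.EisensteinCoeff.isLocalRing_succ p hm
    letI := IwasawaAlgebra.EisensteinCoeff.algebraOfSpecSucc p m
    haveI := W.isScalarTower_algebraOfSpecSucc (K := K) (p := p) (m := m)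
    letI := W.residueModuleSucc (K := K) (p := p) hm
    (((W.eisensteinDVRSetting κ hm S hpS hbad L hL hLS jbar cd D fs).πbar k
        (IwasawaAlgebra.EisensteinCoeff.Twisted.tmul 1 P) : geomTorsion (W.baseChange K) (p : ℤ)) :
        geomPoints (W.baseChange K)) = ((p : ℤ) ^ k) • (P : geomPoints (W.baseChange K)) := by
  have h := (Classical.choose_spec ((W.baseChange K).exists_isQuotientBy_eisensteinTwist_geomTorsion (p := p) κ hm
    (k := k + 1) k.succ_pos)).1 P
  simp only [Nat.add_sub_cancel] at h
  exact h

set_option synthInstance.maxHeartbeats 80000 in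
/-- **The residual presentation IS a presentation of `T^{(k)}/𝔪 T^{(k)}`** (`Howard2004.IsQuotientBy` for the maximal
ideal of `A_{m,k+1}`): the first clause of H.1 for the setting, at every level.
[cite: Howard2004HeegnerKolyvagin, §1.3 H.1 (arXiv p. 7, L59) and proof of Prop. 2.1.3] -/
theorem isQuotientBy_eisensteinDVRSetting_πbar (k : ℕ) :
    letI := IwasawaAlgebra.isDomain_quotient_X_pow_add_C p hm
    letI := IwasawaAlgebra.isDiscreteValuationRing_quotient_X_pow_add_C p hm
    haveI := IwasawaAlgebra.EisensteinCoeff.isLocalRing_succ p hm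
    letI := IwasawaAlgebra.EisensteinCoeff.algebraOfSpecSucc p m
    haveI := W.isScalarTower_algebraOfSpecSucc (K := K) (p := p) (m := m)
    letI := W.residueModuleSucc (K := K) (p := p) hm
    IsQuotientBy ((W.eisensteinTower κ hm).ρ k)
      (@IsLocalRing.maximalIdeal _ _ (IwasawaAlgebra.EisensteinCoeff.isLocalRing_eisensteinCoeff p hm k.succ_pos))
      ((W.baseChange K).torsionGaloisModule (p : ℤ))
      ((W.eisensteinDVRSetting κ hm S hpS hbad L hL hLS jbar cd D fs).πbar k) :=
  (Classical.choose_spec ((W.baseChange K).exists_isQuotientBy_eisensteinTwist_geomTorsion (p := p) κ hm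
    (k := k + 1) k.succ_pos)).2

set_option synthInstance.maxHeartbeats 80000 in
/-- The `G_ℚ`-structure of the setting is `θ = τ_*` (`residualTauGeomTorsion`) at every level.
[cite: Howard2004HeegnerKolyvagin, §1.3 H.5(a) (arXiv p. 7, L93–95)] -/
theorem eisensteinDVRSetting_A (k : ℕ) :
    letI := IwasawaAlgebra.isDomain_quotient_X_pow_add_C p hm
    letI := IwasawaAlgebra.isDiscreteValuationRing_quotient_X_pow_add_C p hm
    haveI := IwasawaAlgebra.EisensteinCoeff.isLocalRing_succ p hm
    letI := IwasawaAlgebra.EisensteinCoeff.algebraOfSpecSucc p m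
    haveI := W.isScalarTower_algebraOfSpecSucc (K := K) (p := p) (m := m)
    letI := W.residueModuleSucc (K := K) (p := p) hm
    (W.eisensteinDVRSetting κ hm S hpS hbad L hL hLS jbar cd D fs).A k =
      W.residualTauGeomTorsion (p := p) cd hm (k := k + 1) k.succ_pos :=
  rfl

set_option synthInstance.maxHeartbeats 80000 in
/-- The level-ring reductions of the setting are `EisensteinCoeff.reduce`. [cite: Howard2004HeegnerKolyvagin, §1.6 (arXiv p. 11, L13–20)] -/
theorem eisensteinDVRSetting_redR (k : ℕ) :
    letI := IwasawaAlgebra.isDomain_quotient_X_pow_add_C p hm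
    letI := IwasawaAlgebra.isDiscreteValuationRing_quotient_X_pow_add_C p hm
    haveI := IwasawaAlgebra.EisensteinCoeff.isLocalRing_succ p hm
    letI := IwasawaAlgebra.EisensteinCoeff.algebraOfSpecSucc p m
    haveI := W.isScalarTower_algebraOfSpecSucc (K := K) (p := p) (m := m)
    letI := W.residueModuleSucc (K := K) (p := p) hm
    (W.eisensteinDVRSetting κ hm S hpS hbad L hL hLS jbar cd D fs).redR k =
      IwasawaAlgebra.EisensteinCoeff.reduce p m (Nat.le_succ (k + 1)) :=
  rfl

set_option synthInstance.maxHeartbeats 80000 in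
/-- The Kolyvagin quotients of the setting are the CANONICAL ones: the action is `eisensteinLevelQuot`.
[cite: Howard2004HeegnerKolyvagin, Def. 1.2.3 (arXiv p. 7, L1–6)] -/
theorem eisensteinDVRSetting_LD_ρq (k : ℕ) (n : Finset (HeightOneSpectrum (𝓞 K))) :
    letI := IwasawaAlgebra.isDomain_quotient_X_pow_add_C p hm
    letI := IwasawaAlgebra.isDiscreteValuationRing_quotient_X_pow_add_C p hm
    haveI := IwasawaAlgebra.EisensteinCoeff.isLocalRing_succ p hm
    letI := IwasawaAlgebra.EisensteinCoeff.algebraOfSpecSucc p m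
    haveI := W.isScalarTower_algebraOfSpecSucc (K := K) (p := p) (m := m)
    letI := W.residueModuleSucc (K := K) (p := p) hm
    ((W.eisensteinDVRSetting κ hm S hpS hbad L hL hLS jbar cd D fs).LD k).ρq n = W.eisensteinLevelQuot κ hm k n :=
  rfl

set_option synthInstance.maxHeartbeats 80000 in
/-- The presentations of the Kolyvagin quotients are the quotient maps. [cite: Howard2004HeegnerKolyvagin, Def. 1.2.3 (arXiv p. 7, L1–6)] -/
theorem eisensteinDVRSetting_LD_π_apply (k : ℕ) (n : Finset (HeightOneSpectrum (𝓞 K)))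
    (x : EisensteinLevel p m (fun j ↦ geomTorsion (W.baseChange K) ((p : ℤ) ^ j)) (k + 1)) :
    letI := IwasawaAlgebra.isDomain_quotient_X_pow_add_C p hm
    letI := IwasawaAlgebra.isDiscreteValuationRing_quotient_X_pow_add_C p hm
    haveI := IwasawaAlgebra.EisensteinCoeff.isLocalRing_succ p hm
    letI := IwasawaAlgebra.EisensteinCoeff.algebraOfSpecSucc p m
    haveI := W.isScalarTower_algebraOfSpecSucc (K := K) (p := p) (m := m)
    letI := W.residueModuleSucc (K := K) (p := p) hm
    ((W.eisensteinDVRSetting κ hm S hpS hbad L hL hLS jbar cd D fs).LD k).π n x = Submodule.Quotient.mk x :=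
  rfl

set_option synthInstance.maxHeartbeats 80000 in
/-- The finite–singular maps of the setting are the caller's `fs`. [cite: Howard2004HeegnerKolyvagin, Def. 1.2.3 display (ks relations) (arXiv p. 6, L126–140)] -/
theorem eisensteinDVRSetting_LD_fs (k : ℕ) :
    letI := IwasawaAlgebra.isDomain_quotient_X_pow_add_C p hm
    letI := IwasawaAlgebra.isDiscreteValuationRing_quotient_X_pow_add_C p hm
    haveI := IwasawaAlgebra.EisensteinCoeff.isLocalRing_succ p hm
    letI := IwasawaAlgebra.EisensteinCoeff.algebraOfSpecSucc p m
    haveI := W.isScalarTower_algebraOfSpecSucc (K := K) (p := p) (m := m)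
    letI := W.residueModuleSucc (K := K) (p := p) hm
    ((W.eisensteinDVRSetting κ hm S hpS hbad L hL hLS jbar cd D fs).LD k).fs = fs k :=
  rfl

set_option synthInstance.maxHeartbeats 80000 in
/-- The reductions of the Kolyvagin quotients of the setting are `eisensteinLevelQuotRed`.
[cite: Howard2004HeegnerKolyvagin, §1.6 (arXiv p. 11, L49–50)] -/
theorem eisensteinDVRSetting_rq (k : ℕ) (n : Finset (HeightOneSpectrum (𝓞 K))) :
    letI := IwasawaAlgebra.isDomain_quotient_X_pow_add_C p hm
    letI := IwasawaAlgebra.isDiscreteValuationRing_quotient_X_pow_add_C p hm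
    haveI := IwasawaAlgebra.EisensteinCoeff.isLocalRing_succ p hm
    letI := IwasawaAlgebra.EisensteinCoeff.algebraOfSpecSucc p m
    haveI := W.isScalarTower_algebraOfSpecSucc (K := K) (p := p) (m := m)
    letI := W.residueModuleSucc (K := K) (p := p) hm
    (W.eisensteinDVRSetting κ hm S hpS hbad L hL hLS jbar cd D fs).rq k n =
      κ.eisensteinLevelQuotRed (fun j ↦ (W.baseChange K).torsionGaloisModule ((p : ℤ) ^ j))
        (fun j ↦ (W.baseChange K).torsionGaloisModuleReduce p j) hm
        (fun j ↦ (W.baseChange K).torsionGaloisModuleReduce_surjective p j)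
        (fun j ↦ (W.baseChange K).torsionGaloisModuleReduce_eq_zero_iff p j) k n :=
  rfl

set_option synthInstance.maxHeartbeats 80000 in
/-- The singular-quotient reductions of the setting are `eisensteinLevelQuotRedSingular`.
[cite: Howard2004HeegnerKolyvagin, Def. 1.2.3 display (ks relations) (arXiv p. 6, L126–140)] -/
theorem eisensteinDVRSetting_fsQ (k : ℕ) (n : Finset (HeightOneSpectrum (𝓞 K))) (v : HeightOneSpectrum (𝓞 K)) :
    letI := IwasawaAlgebra.isDomain_quotient_X_pow_add_C p hm
    letI := IwasawaAlgebra.isDiscreteValuationRing_quotient_X_pow_add_C p hm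
    haveI := IwasawaAlgebra.EisensteinCoeff.isLocalRing_succ p hm
    letI := IwasawaAlgebra.EisensteinCoeff.algebraOfSpecSucc p m
    haveI := W.isScalarTower_algebraOfSpecSucc (K := K) (p := p) (m := m)
    letI := W.residueModuleSucc (K := K) (p := p) hm
    (W.eisensteinDVRSetting κ hm S hpS hbad L hL hLS jbar cd D fs).fsQ k n v =
      κ.eisensteinLevelQuotRedSingular (fun j ↦ (W.baseChange K).torsionGaloisModule ((p : ℤ) ^ j))
        (fun j ↦ (W.baseChange K).torsionGaloisModuleReduce p j) hm
        (fun j ↦ (W.baseChange K).torsionGaloisModuleReduce_surjective p j)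
        (fun j ↦ (W.baseChange K).torsionGaloisModuleReduce_eq_zero_iff p j) k n v :=
  rfl

end WeierstrassCurve

end
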